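/-
Copyright (c) 2026 the pub-hodgecm-mathlib formalisation cell (harness21).  Prover seat hodgecm-mathlib-F0P3a-p01 (g16): road «S3-ram» (LEAD F0P3a-plan (g12); architect
A-p16 (g31) 22:49:18Z «(a2) SHELL SUMS → p01»), organ A′ (ii) (a2) part (C1, equilateral): the ROOT REGION is the root; 2026-09-01.
-/
import Literature.NumberTheory.Automorphic.UnitaryLatticeTreeLevelShift     -- ★ (F0P2-p01 (g13)): `mapGL_eq_and_level_iff_map_levelShift_le`, `map_one_add_le_iff`; brings ★ `UnitaryLatticeTreeTypes` ∕ `Dual` ∕ `Defs`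
import HarnessLib

/-!
# The lattice graph of a hermitian space — a residually SEPARABLE diagonal endomorphism stabilises only DIAGONAL lattices; for a diagonal unit form the only
# self-dual one is the root (Bruhat–Tits 1972 §10; Kottwitz 1986 §3; Serre, *Trees* II.1.1)

Topic `NumberTheory/Automorphic`; namespace `Literature.NumberTheory.Automorphic.UnitaryLatticeTree`.  THEOREMS ONLY (no definition, no instance, no notation, no named fact,
no `sorry`); kernel lane `--supports stmt-HodgeConjecture-24833`; datum-free (`K` with `Valued K ℤᵐ⁰`, `σ` valuation-preserving).  Cell `pub/hodgecm-mathlib` (D-0151), crux H413;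
road «S3-ram» (Literature seeding, count-neutral), P-1-ram organ A′ (ii) (a2) «SHELL SUMS», part (C1) of the root-bookkeeping design
`F0/P3a/F0P3a-p01/g16/rootbook/DESIGN-a2C-RootBookkeeping.v1…md` §0 (R4), §1: in the EQUILATERAL configuration (`N₁ = N₂ = N = d₀`) the root region
`R = {fixed self-dual L : d_L = d₀}` of a ramified type-(1) literal `t = P·diag(λ)·P⁻¹` is `{L₀}` alone — every other fixed vertex is in the nilpotent regime of ★ p847094.

THE MATHEMATICS (in the eigenframe, i.e. for the DIAGONAL hermitian form `H = diag(h)` with UNIT entries and the diagonal element; the literal's frame `P ∈ GL₃(𝒪)` transports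
it, ★ p846940).  Let `S = diag(s₀, s₁, s₂) ∈ M₃(𝒪)` be RESIDUALLY SEPARABLE: `|s_i − s_j| = 1` for `i ≠ j` (at the root: `S = π^{−d₀}(t − 1)`, separable iff `ord_π(λ_i − λ_j) = d₀`
for all `i ≠ j` — the equilateral condition).  (§1) If an `𝒪`-submodule `M ⊆ K³` is `S`-stable then it is COORDINATE-CLOSED: `x ∈ M ⇒ x_i e_i ∈ M` — the Lagrange idempotents
`E_i = Π_{j≠i}(S − s_j)∕(s_i − s_j)` lie in `𝒪[S]` (unit denominators) and `E_i x = x_i e_i`; typed as two successive integral operators `(s_i − s_j)⁻¹(S − s_j)` killing the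
coordinates `j ≠ i` one at a time.  (§2) If moreover `M ≤ M^♯` for `H = diag(h)`, `|h_i| = 1` (every vertex lattice: ★ `le_dualLatt_of_isVertexLattice`), then
`|h_i|·|x_i|² = |pairing(x_ie_i, x_ie_i)| ≤ 1` forces `|x_i| ≤ 1`: `M ≤ L₀ = 𝒪³`.  (§3) `L₀` is self-dual for `diag(h)` (Gram `diag(h)`, unimodular), so a SELF-DUAL `S`-stable `M`
equals `L₀` (★ `eq_of_le_of_isVertexLattice`: comparable vertices of the same type coincide).  (§4) In the tree's language (★ shift law `mapGL_eq_and_level_iff_map_levelShift_le`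
+ ★ `map_one_add_le_iff`): a self-dual vertex FIXED AT LEVEL `c` by `γ = 1 + c·S` (`0 < |c| < 1`) is the root.  Hence (memo §1) in the equilateral configuration the root's
`(q+1)q` children already carry nilpotent labels (`E_k` over the null isotropic lines of the root form, `P^±_{k−1}` over the others — ★ p847132 counts them, ★ p847102 labels them).
HONEST LABEL: HC_CM is proved only modulo the 2 remaining named inputs (hLiu418 24832, h413 24833) until rung 0 closes; nothing printed is asserted here (elementary lattice
algebra over a valuation ring).

## References
* [BruhatTits1972] F. Bruhat, J. Tits, *Groupes réductifs sur un corps local I*, Publ. Math. IHÉS 41 (1972), §10 (apartments: lattices split along an eigenframe).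
* [Kottwitz1986] R. E. Kottwitz, *Base change for unit elements of Hecke algebras*, Compositio Math. 60 (1986), §3 (fixed lattices as modules over the order `𝒪[γ]`).
* [Serre1980Trees] J.-P. Serre, *Trees* (1980), Ch. II §1.1 (lattices stable under a split semisimple element lie on its apartment).
-/

set_option autoImplicit false

noncomputable section

open scoped Valued WithZero Matrix MatrixGroups

namespace Literature.NumberTheory.Automorphic.UnitaryLatticeTree

open Literature.NumberTheory.Automorphic Literature.NumberTheory.Automorphic.HermitianLattice

variable {K : Type*} [Field K] [Valued K ℤᵐ⁰]

/-! ## §1 A residually separable diagonal endomorphism makes a stable lattice coordinate-closed -/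

/-- One Lagrange step: if `M` is stable under `diag(s)` then it is stable under the INTEGRAL operator `(s_i − s_j)⁻¹·(diag(s) − s_j)` (`|s_i − s_j| = 1`, `|s_l| ≤ 1`), which
multiplies the `l`-th coordinate by `(s_l − s_j)∕(s_i − s_j)` — kills `j`, fixes `i`. [cite: Kottwitz1986, §3] [cite: Serre1980Trees, II.1.1] -/
theorem smul_sub_mem_of_map_diagonal_le {N : ℕ} {s : Fin N → K} (hs : ∀ l, Valued.v (s l) ≤ 1)
    {M : Submodule 𝒪[K] (Fin N → K)} (hSM : M.map ((Matrix.toLin' (Matrix.diagonal s)).restrictScalars 𝒪[K]) ≤ M)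
    {i j : Fin N} (hij : Valued.v (s i - s j) = 1) {x : Fin N → K} (hx : x ∈ M) :
    (fun l => (s i - s j)⁻¹ * (s l - s j) * x l) ∈ M := by
  have hsx : (fun l => s l * x l) ∈ M := by
    have h := hSM (Submodule.mem_map.2 ⟨x, hx, rfl⟩)
    rw [LinearMap.restrictScalars_apply, Matrix.toLin'_apply, show Matrix.diagonal s *ᵥ x = fun l => s l * x l from funext (Matrix.mulVec_diagonal s x)] at h
    exact h
  have hne : s i - s j ≠ 0 := fun h0 => by rw [h0, map_zero] at hij; exact zero_ne_one hij
  -- `(s i − s j)⁻¹ ∈ 𝒪` and `s j ∈ 𝒪` act as scalars of `𝒪`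
  have hinv : Valued.v (s i - s j)⁻¹ ≤ 1 := by rw [map_inv₀, hij, inv_one]
  have hmem : (⟨(s i - s j)⁻¹, (mem_integer_iff' _).2 hinv⟩ : 𝒪[K]) • ((fun l => s l * x l) - (⟨s j, (mem_integer_iff' _).2 (hs j)⟩ : 𝒪[K]) • x) ∈ M :=
    M.smul_mem _ (M.sub_mem hsx (M.smul_mem _ hx))
  convert hmem using 1
  ext l
  simp only [Pi.smul_apply, Pi.sub_apply, Algebra.smul_def]
  change _ = (s i - s j)⁻¹ * (s l * x l - s j * x l)
  ring

/-- **COORDINATE CLOSURE** (`N = 3`): if `M ⊆ K³` is stable under a residually separable integral `diag(s)` (`|s_l| ≤ 1`, `|s_i − s_j| = 1` for `i ≠ j`), then for every `x ∈ M`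
and every `i`, `x_i e_i ∈ M` (the Lagrange idempotent `E_i ∈ 𝒪[diag(s)]`). [cite: Kottwitz1986, §3] [cite: BruhatTits1972, §10] -/
theorem single_apply_mem_of_map_diagonal_le {s : Fin 3 → K} (hs : ∀ l, Valued.v (s l) ≤ 1) (hsep : ∀ i j, i ≠ j → Valued.v (s i - s j) = 1)
    {M : Submodule 𝒪[K] (Fin 3 → K)} (hSM : M.map ((Matrix.toLin' (Matrix.diagonal s)).restrictScalars 𝒪[K]) ≤ M)
    {x : Fin 3 → K} (hx : x ∈ M) (i : Fin 3) : Pi.single i (x i) ∈ M := by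
  -- the two other indices
  obtain ⟨j, j', hj, hj', hjj', hcover⟩ : ∃ j j' : Fin 3, j ≠ i ∧ j' ≠ i ∧ j ≠ j' ∧ ∀ l, l = i ∨ l = j ∨ l = j' := by
    fin_cases i
    · exact ⟨1, 2, by decide, by decide, by decide, fun l => by fin_cases l <;> decide⟩
    · exact ⟨0, 2, by decide, by decide, by decide, fun l => by fin_cases l <;> decide⟩
    · exact ⟨0, 1, by decide, by decide, by decide, fun l => by fin_cases l <;> decide⟩
  have h1 := smul_sub_mem_of_map_diagonal_le hs hSM (hsep i j hj.symm) hx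
  have h2 := smul_sub_mem_of_map_diagonal_le hs hSM (hsep i j' hj'.symm) h1
  convert h2 using 1
  ext l
  have hne : s i - s j ≠ 0 := fun h0 => by have := hsep i j hj.symm; rw [h0, map_zero] at this; exact zero_ne_one this
  have hne' : s i - s j' ≠ 0 := fun h0 => by have := hsep i j' hj'.symm; rw [h0, map_zero] at this; exact zero_ne_one this
  rcases hcover l with rfl | rfl | rfl
  · rw [Pi.single_eq_same, inv_mul_cancel₀ hne', one_mul, inv_mul_cancel₀ hne, one_mul]
  · rw [Pi.single_eq_of_ne hj, sub_self, mul_zero, zero_mul, mul_zero]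
  · rw [Pi.single_eq_of_ne hj', sub_self, mul_zero, zero_mul]

/-! ## §2 Coordinate-closed and integral pairings ⇒ inside the root -/

/-- If `M` is coordinate-closed and `M ≤ M^♯` for the diagonal form `diag(h)` with unit entries, then `M ≤ L₀ = 𝒪^N`
(`|pairing(x_ie_i, x_ie_i)| = |h_i|·|x_i|² ≤ 1`). [cite: BruhatTits1972, §10] [cite: Serre1980Trees, II.1.1] -/
theorem le_stdLattice_of_coord_of_le_dualLatt {N : ℕ} {σ : K →+* K} (hvσ : ∀ a, Valued.v (σ a) = Valued.v a) {h : Fin N → K} (hh : ∀ i, Valued.v (h i) = 1)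
    {M : Submodule 𝒪[K] (Fin N → K)} (hMd : M ≤ dualLatt σ (Matrix.diagonal h) M) (hcoord : ∀ x ∈ M, ∀ i, Pi.single i (x i) ∈ M) :
    M ≤ stdLattice K N := by
  intro x hx
  rw [mem_stdLattice]
  intro i
  have hy := hcoord x hx i
  have hpair := (mem_dualLatt σ _ M _).1 (hMd hy) _ hy
  have hval : pairing σ (Matrix.diagonal h) (Pi.single i (x i)) (Pi.single i (x i)) = σ (x i) * h i * x i := by
    rw [show (Pi.single i (x i) : Fin N → K) = x i • (Pi.single i (1 : K)) by rw [← Pi.single_smul', smul_eq_mul, mul_one],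
      LinearMap.map_smulₛₗ₂, LinearMap.map_smul, pairing_single_single, Matrix.diagonal_apply_eq]
    simp only [smul_eq_mul]; ring
  rw [hval, map_mul, map_mul, hvσ, hh, mul_one] at hpair
  by_contra hgt
  rw [not_le] at hgt
  have : (1 : ℤᵐ⁰) < Valued.v (x i) * Valued.v (x i) := one_lt_mul'' hgt hgt
  exact (not_le.2 this) hpair

/-! ## §3 The root is self-dual for a diagonal unit form; the HEAD -/

/-- `L₀ = 𝒪^N` is a self-dual vertex for `diag(h)` with unit entries. [cite: BruhatTits1972, §10] -/
theorem isSelfDualLattice_stdLattice_diagonal {N : ℕ} (σ : K →+* K) {ϖ : K} (hϖ : Valued.v ϖ ≤ 1) {h : Fin N → K} (hh : ∀ i, Valued.v (h i) = 1) :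
    IsSelfDualLattice σ ϖ (Matrix.diagonal h) (stdLattice K N) := by
  have hne : ∀ i, h i ≠ 0 := fun i h0 => by have := hh i; rw [h0, map_zero] at this; exact zero_ne_one this
  have hG : formCongr σ (1 : GL (Fin N) K) (Matrix.diagonal h) = Matrix.diagonal h := by
    rw [formCongr, Units.val_one, Matrix.map_one σ (map_zero σ) (map_one σ), Matrix.transpose_one, Matrix.one_mul, Matrix.mul_one]
  have hinv : (Matrix.diagonal h)⁻¹ = Matrix.diagonal fun i => (h i)⁻¹ := by
    refine Matrix.inv_eq_left_inv ?_
    rw [Matrix.diagonal_mul_diagonal]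
    convert Matrix.diagonal_one with i
    exact inv_mul_cancel₀ (hne i)
  refine ⟨1, by rw [Units.val_one, latt_one], ?_, ?_, ?_⟩
  · intro i j
    rw [hG]
    by_cases hij : i = j
    · subst hij; rw [Matrix.diagonal_apply_eq, hh]
    · rw [Matrix.diagonal_apply_ne _ hij, map_zero]; exact zero_le
  · intro i j
    rw [hG, hinv, Matrix.smul_apply, smul_eq_mul]
    by_cases hij : i = j
    · subst hij
      rw [Matrix.diagonal_apply_eq, map_mul, map_inv₀, hh, inv_one, mul_one]; exact hϖ
    · rw [Matrix.diagonal_apply_ne _ hij, mul_zero, map_zero]; exact zero_le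
  · rw [hG, Matrix.det_diagonal, map_prod, pow_zero]
    exact Finset.prod_eq_one fun i _ => hh i

/-- **HEAD (eigenframe form): A SELF-DUAL LATTICE STABLE UNDER A RESIDUALLY SEPARABLE INTEGRAL DIAGONAL ENDOMORPHISM IS THE ROOT.**  For `H = diag(h)` with unit entries and
`S = diag(s)`, `|s_l| ≤ 1`, `|s_i − s_j| = 1` (`i ≠ j`): `IsSelfDualLattice σ ϖ H M ∧ S·M ⊆ M ⇒ M = L₀`.  (Equilateral root region of the memo: `S = π^{−d₀}(t − 1)` in the literal's
eigenframe.) [cite: BruhatTits1972, §10] [cite: Kottwitz1986, §3] [cite: Serre1980Trees, II.1.1] -/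
theorem eq_stdLattice_of_isSelfDualLattice_of_map_diagonal_le {σ : K →+* K} (hvσ : ∀ a, Valued.v (σ a) = Valued.v a) {ϖ : K} (hϖ0 : ϖ ≠ 0) (hϖ1 : Valued.v ϖ ≤ 1)
    {h : Fin 3 → K} (hh : ∀ i, Valued.v (h i) = 1) {s : Fin 3 → K} (hs : ∀ l, Valued.v (s l) ≤ 1) (hsep : ∀ i j, i ≠ j → Valued.v (s i - s j) = 1)
    {M : Submodule 𝒪[K] (Fin 3 → K)} (hM : IsSelfDualLattice σ ϖ (Matrix.diagonal h) M)
    (hSM : M.map ((Matrix.toLin' (Matrix.diagonal s)).restrictScalars 𝒪[K]) ≤ M) : M = stdLattice K 3 :=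
  eq_of_le_of_isVertexLattice hvσ hϖ0 hM (isSelfDualLattice_stdLattice_diagonal σ hϖ1 hh)
    (le_stdLattice_of_coord_of_le_dualLatt hvσ hh (le_dualLatt_of_isVertexLattice hvσ hM)
      fun _ hx i => single_apply_mem_of_map_diagonal_le hs hsep hSM hx i)

/-! ## §4 In the tree's language: a self-dual vertex fixed AT LEVEL `c` by `γ = 1 + c·diag(s)` is the root -/

/-- **THE EQUILATERAL ROOT REGION IS `{L₀}`** (eigenframe form): if `γ = 1 + c·diag(s)` with `0 < |c| < 1` and `diag(s)` residually separable and integral, then a self-dual vertex `M`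
(for the diagonal unit form) with `γ·M = M` and `(γ − 1)·M ⊆ c·M` (fixed AT LEVEL `c`; for the literal `t = P·diag(λ)·P⁻¹` at a tame-ramified place, `c = ϖ_w^{d₀}`, `d₀ = ord(λ_i − λ_j)`
for all `i ≠ j`) is the root `L₀` — ★ shift law `mapGL_eq_and_level_iff_map_levelShift_le` + ★ `map_one_add_le_iff` + §3. [cite: Kottwitz1986, §3] [cite: Serre1980Trees, II.1.1]
[cite: BruhatTits1972, §10] -/
theorem eq_stdLattice_of_isSelfDualLattice_of_levelFixed_diagonal {σ : K →+* K} (hvσ : ∀ a, Valued.v (σ a) = Valued.v a) {ϖ : K} (hϖ0 : ϖ ≠ 0) (hϖ1 : Valued.v ϖ ≤ 1)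
    {h : Fin 3 → K} (hh : ∀ i, Valued.v (h i) = 1) {s : Fin 3 → K} (hs : ∀ l, Valued.v (s l) ≤ 1) (hsep : ∀ i j, i ≠ j → Valued.v (s i - s j) = 1)
    {c : K} (hc : c ≠ 0) (hc1 : Valued.v c < 1) (γ : GL (Fin 3) K) (hγ : (γ : Matrix (Fin 3) (Fin 3) K) = 1 + c • Matrix.diagonal s)
    {M : Submodule 𝒪[K] (Fin 3 → K)} (hM : IsSelfDualLattice σ ϖ (Matrix.diagonal h) M) (hfix : mapGL γ M = M)
    (hlev : M.map ((Matrix.toLin' ((γ : Matrix (Fin 3) (Fin 3) K) - 1)).restrictScalars 𝒪[K]) ≤ scaleLattice c M) :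
    M = stdLattice K 3 := by
  obtain ⟨g, hMg, -, -, -⟩ := id hM
  have key := (mapGL_eq_and_level_iff_map_levelShift_le hc hc1 γ g).1 ⟨hMg ▸ hfix, hMg ▸ hlev⟩
  rw [hγ, add_sub_cancel_left, inv_smul_smul₀ hc, map_one_add_le_iff, ← hMg] at key
  exact eq_stdLattice_of_isSelfDualLattice_of_map_diagonal_le hvσ hϖ0 hϖ1 hh hs hsep hM key

end Literature.NumberTheory.Automorphic.UnitaryLatticeTree

end
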